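import Summits.BirchSwinnertonDyer.BirchSwinnertonDyer.Theorems.KatoDescentPotSupersingularZetaBodyRankOneDecoupling
import Summits.BirchSwinnertonDyer.Rank1Residual.GaloisImage.KatoDepletedLValue
import Literature.NumberTheory.EllipticCurves.AnalyticRankWindow
import HarnessLib

/-!
# The bottom value of the tree's Kato zeta data VANISHES on the rank-one rows: `x_{0,∅} = 0` from
# `1 ≤ r_an(W)` (with `f` the newform of `W` and `L(W,s)` entire) — so the rank-one decoupling of
# PART 18a applies LITERALLY under the hypothesis of the residual items K9 `WildRankOne` 19200 /
# KT `TameRankOne` 19984 (`W.analyticRank = 1`)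

Cell `bsd-potss` (FULL-BSD rank ≤ 1, tranche 1b), seat `bsd-potss-kmc`, generation 11, PART 18c; memo
HOME/bsd-potss-kmc/KMC-DESCENT-MEMO-v10.md §1.  ROUTE-FREE; `--supports stmt-BirchSwinnertonDyer-19200`.

WHAT THIS SHOWS.  PART 18a (`ZetaBodyScaling.zetaBody_smul_offBottom` & co., p480242) decouples the scale
of Kato's classes from `(κ, Λ_{0,∅})` under the hypothesis `x 0 idealOne = 0` (the bottom value of
`Kato2004.ZetaBody` vanishes), and `bottomValue_eq_zero_of_depletedL_one_eq_zero` derives that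
hypothesis from the vanishing at `s = 1` of an entire continuation of Kato's `(pA)`-depleted series.
Here the last step to the items' own hypothesis is supplied: for `f` the newform of `W`
(`IsNewformOf W f`), `L(W,s)` entire (`W.HasEntireLFunction`, the tree's standing analytic input) and
`1 ≤ W.analyticRank`, every entire continuation `L` of the depleted series has `L(1) = 0`
(`depletedL_one_eq_zero_of_analyticRank_pos`: by the tree's depletion identity
`DepletedLValue.depletedTwistedL_one_eq_ratCast_prod_mul`, `L(1) = E·L(W,1)` with `E ∈ ℚ`, and
`L(W,1) = 0` below the analytic rank, `iteratedDeriv_entireLFunction_one_eq_zero`), hence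
`x_{0,∅} = 0` (`bottomValue_eq_zero_of_analyticRank_pos`) and the decoupling holds on every row of the
two residual items (`zetaBody_smul_offBottom_of_analyticRank_pos`,
`exists_zetaBody_smul_bottom_smul_of_analyticRank_pos`).  Nothing about BSD is asserted; no definition,
no named fact (the modularity link `L(f,s) = L(W,s)` is the THEOREM `IsNewformOf.cuspFormLSeries_eq` +
`entireLFunction_eq_LSeries` under `HasEntireLFunction`, not the fact `IsNewformOf.entireLFunction_eq`).

References: K. Kato, Astérisque 295 (2004) §6.2, Thm. 6.6 (1), Thm. 9.7, Ex. 13.3 [Kato2004Asterisque];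
J. Cremona, *Algorithms for modular elliptic curves* (1997) §2.13 [CremonaAlgorithms1997]; tree
`Rank1Residual/GaloisImage/KatoDepletedLValue` (depletion identity), `Literature/…/AnalyticRankWindow`.
-/

set_option autoImplicit false
set_option linter.dupNamespace false

noncomputable section

open scoped NumberField TensorProduct Pointwise Classical
open Field IsDedekindDomain CongruenceSubgroup
open Literature.NumberTheory.GaloisRepresentations
open Literature.NumberTheory.EllipticCurves Literature.NumberTheory.EllipticCurves.ModularForms
open Literature.NumberTheory.EllipticCurves.Kato2004
open Literature.NumberTheory.EllipticCurves.Kato2004.EulerSystemValues Rat.HeightOneSpectrum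

namespace Summit.BirchSwinnertonDyer.BirchSwinnertonDyer.Theorems.ZetaBodyScaling

/-! ## §1 The depleted `L`-value vanishes below the analytic rank -/

section Depleted

variable {W : WeierstrassCurve ℚ} [W.IsElliptic] {N : ℕ} [NeZero N] {f : CuspForm (Gamma0 N) 2}

omit [W.IsElliptic] [NeZero N] in
/-- Transport of `IsDepletedTwistedL` at the trivial character along an equality of levels `m = 1`
(the bottom cyclotomic level `cycLevel p 0 ∅` equals `1` only propositionally, `KatoValue.cycLevel_zero_empty`).
[cite: Kato2004Asterisque, §6.2 (p. 161)] -/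
theorem isDepletedTwistedL_one_of_eq {m : ℕ} (hm : m = 1) {M : ℕ} {L : ℂ → ℂ}
    (h : IsDepletedTwistedL f 1 M (1 : DirichletCharacter ℂ 1) L) :
    IsDepletedTwistedL f m M (1 : DirichletCharacter ℂ m) L := by
  subst hm
  exact h

/-- **Below the analytic rank the depleted `L`-value vanishes.**  For `f` the newform of `W`, `L(W,s)`
entire and `1 ≤ r_an(W)`: every entire continuation `L` of Kato's `M`-depleted series
`Σ_{(n,M)=1} a_n n^{-s}` (trivial character, `IsDepletedTwistedL f 1 M 1 L`) satisfies `L(1) = 0` —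
`L(1) = E·L(W,1)` for a rational `E` (tree `DepletedLValue.depletedTwistedL_one_eq_ratCast_prod_mul`,
with `L₀ = L(W,·)` continuing `L(f,s) = L(W,s)`), and `L(W,1) = 0` (`iteratedDeriv_entireLFunction_one_eq_zero`
at `k = 0`). [cite: Kato2004Asterisque, §6.2 (p. 161) and Ex. 13.3 (p. 225)]
[cite: CremonaAlgorithms1997, §2.13 p. 37] -/
theorem depletedL_one_eq_zero_of_analyticRank_pos (hf : IsNewformOf W f) (hL : W.HasEntireLFunction)
    (hr : 1 ≤ W.analyticRank) {M : ℕ} [NeZero M] {L : ℂ → ℂ}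
    (hS : IsDepletedTwistedL f 1 M (1 : DirichletCharacter ℂ 1) L) : L 1 = 0 := by
  have hL₀ : Differentiable ℂ W.entireLFunction := W.differentiable_entireLFunction hL
  have hL₀s : ∀ s : ℂ, 2 < s.re → W.entireLFunction s = cuspFormLSeries f s := by
    intro s hs
    rw [hf.cuspFormLSeries_eq, W.entireLFunction_eq_LSeries hL (by linarith)]
  have h0 : W.entireLFunction 1 = 0 := by
    have h := iteratedDeriv_entireLFunction_one_eq_zero W hL (k := 0) (by omega)
    simpa only [iteratedDeriv_zero] using h
  rw [Rank1Residual.GaloisImage.DepletedLValue.depletedTwistedL_one_eq_ratCast_prod_mul hf hS hL₀ hL₀s,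
    h0, mul_zero]

end Depleted

/-! ## §2 The bottom value of the zeta data vanishes on the rank-one rows; the decoupling there -/

section BottomValue

variable {W : WeierstrassCurve ℚ} [W.IsElliptic] {p : ℕ} [Fact p.Prime]
  [ContinuousSMul ℤ_[p] (W.tateModule p)] [Module.Free ℤ_[p] (W.tateModule p)]
  [Module.Finite ℤ_[p] (W.tateModule p)] {N : ℕ} [NeZero N] {f : CuspForm (Gamma0 N) 2}
  {ι : (m : ℕ) → (CyclotomicField m ℚ →+* ℂ)} {κ : ℝ}
  {Λ : ∀ (k : ℕ) (r : Finset (HeightOneSpectrum (𝓞 ℚ))),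
    H1 (tateRep W p) (cycSubgroup p k r) →ₗ[ℤ_[p]] ℚ_[p] ⊗[ℚ] CyclotomicField (cycLevel p k r) ℚ}
  {c d a : ℤ} {A : ℕ} [NeZero A]
  {z : ∀ (k : ℕ) (r : (cyclotomicLevelsRat p (badPlaces c d A N)).Ideals),
    H1 (tateRep W p) ((cyclotomicLevelsRat p (badPlaces c d A N)).level k r.1)}
  {x : ∀ (k : ℕ) (r : (cyclotomicLevelsRat p (badPlaces c d A N)).Ideals),
    CyclotomicField (cycLevel p k r.1) ℚ}

/-- **The bottom value of Kato's zeta data vanishes in positive analytic rank.**  For `f` the newform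
of `W`, `L(W,s)` entire, `1 ≤ r_an(W)`, the guards `(cd, A) = 1`, `dd′ ≡ 1 (A)` of (C5), and ANY entire
continuation `L` of the `(pA)`-depleted series at the trivial character (the (C5) clause quantifies over
them): `x 0 idealOne = 0`. [cite: Kato2004Asterisque, Thm. 9.7 (p. 189), Thm. 6.6 (1) (p. 163), §6.2 (p. 161)] -/
theorem bottomValue_eq_zero_of_analyticRank_pos (h : ZetaBody W p f ι κ Λ c d a A z x)
    (hf : IsNewformOf W f) (hL : W.HasEntireLFunction) (hr : 1 ≤ W.analyticRank)
    (d' : ℤ) (hcd : Int.gcd (c * d) A = 1) (hdd' : d * d' ≡ 1 [ZMOD (A : ℤ)]) {L : ℂ → ℂ}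
    (hS : IsDepletedTwistedL f 1 (p * A) (1 : DirichletCharacter ℂ 1) L) :
    x 0 (cyclotomicLevelsRat p (badPlaces c d A N)).idealOne = 0 :=
  haveI : NeZero (p * A) := ⟨mul_ne_zero (Fact.out : p.Prime).ne_zero (NeZero.ne A)⟩
  bottomValue_eq_zero_of_depletedL_one_eq_zero h d' hcd hdd'
    (isDepletedTwistedL_one_of_eq (Rank1Residual.GaloisImage.KatoValue.cycLevel_zero_empty p) hS)
    (depletedL_one_eq_zero_of_analyticRank_pos hf hL hr hS)

/-- **RANK-ONE DECOUPLING ON THE RESIDUAL ROWS.**  Under the items' hypothesis `1 ≤ r_an(W)` (with the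
newform `f` of `W`, `L(W,s)` entire, the (C5) guards and one entire depleted continuation): for every
`n ≠ 0` the classes scale `z ↦ n•z` with `κ`, the values `x` AND the bottom functional `Λ_{0,∅}` fixed
(PART 18a `zetaBody_smul_offBottom`).  Hence no clause on `(κ, Λ_{0,∅})` pins the `Λ`-adic class on the
rows of `WildRankOne` / `TameRankOne`. [cite: Kato2004Asterisque, §9.4 (p. 188), Thm. 9.7 (p. 189), Thm. 6.6 (1) (p. 163)]
[cite: BurnsKuriharaSano2019, Hyp. 2.2 and Remark 2.3 (p. 9)] -/
theorem zetaBody_smul_offBottom_of_analyticRank_pos (h : ZetaBody W p f ι κ Λ c d a A z x)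
    (hf : IsNewformOf W f) (hL : W.HasEntireLFunction) (hr : 1 ≤ W.analyticRank)
    (d' : ℤ) (hcd : Int.gcd (c * d) A = 1) (hdd' : d * d' ≡ 1 [ZMOD (A : ℤ)]) {L : ℂ → ℂ}
    (hS : IsDepletedTwistedL f 1 (p * A) (1 : DirichletCharacter ℂ 1) L) {n : ℕ} (hn : n ≠ 0) :
    ZetaBody W p f ι κ
      (fun k r ↦ (if k = 0 ∧ r = ∅ then (1 : ℚ_[p]) else (n : ℚ_[p])⁻¹) • Λ k r)
      c d a A ((n : ℤ_[p]) • z) x :=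
  zetaBody_smul_offBottom hn (bottomValue_eq_zero_of_analyticRank_pos h hf hL hr d' hcd hdd' hS) h

/-- **The pair `(κ, Λ_{0,∅})` carries no constraint on the residual rows** (PART 18a
`exists_zetaBody_smul_bottom_smul` under `1 ≤ r_an(W)`): for every `n ≠ 0` and `t ∈ ℚ_p` some
functional family `Λ'` with `Λ'_{0,∅} = t • Λ_{0,∅}` makes `(κ, Λ', n•z, x)` satisfy `ZetaBody`.
[cite: Kato2004Asterisque, §9.4 (p. 188), Thm. 9.7 (p. 189), Thm. 6.6 (1) (p. 163)] -/
theorem exists_zetaBody_smul_bottom_smul_of_analyticRank_pos (h : ZetaBody W p f ι κ Λ c d a A z x)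
    (hf : IsNewformOf W f) (hL : W.HasEntireLFunction) (hr : 1 ≤ W.analyticRank)
    (d' : ℤ) (hcd : Int.gcd (c * d) A = 1) (hdd' : d * d' ≡ 1 [ZMOD (A : ℤ)]) {L : ℂ → ℂ}
    (hS : IsDepletedTwistedL f 1 (p * A) (1 : DirichletCharacter ℂ 1) L) {n : ℕ} (hn : n ≠ 0)
    (t : ℚ_[p]) :
    ∃ Λ' : ∀ (k : ℕ) (r : Finset (HeightOneSpectrum (𝓞 ℚ))),
        H1 (tateRep W p) (cycSubgroup p k r) →ₗ[ℤ_[p]] ℚ_[p] ⊗[ℚ] CyclotomicField (cycLevel p k r) ℚ,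
      Λ' 0 ∅ = t • Λ 0 ∅ ∧ ZetaBody W p f ι κ Λ' c d a A ((n : ℤ_[p]) • z) x :=
  exists_zetaBody_smul_bottom_smul hn t
    (bottomValue_eq_zero_of_analyticRank_pos h hf hL hr d' hcd hdd' hS) h

end BottomValue

end Summit.BirchSwinnertonDyer.BirchSwinnertonDyer.Theorems.ZetaBodyScaling

end
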